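/-
Copyright (c) 2026 the pub-hodgecm-mathlib formalisation cell (harness21).  Prover seat hodgecm-mathlib-LH4-p12 (g7), req620 Track A «(D-RAM) FOUR-FRAME», line LH4
(STAGE-1b tier-0 LEVEL rows, (L-lev) labelled trunk (d)-lev PART 4 (dealer WORD #83): THE ASSEMBLY — the two-token twin of ★ p860129: ★ TRUNK p857082's steps (3)–(5) over
the label-cut partition ★ p859743 (label-generic), LH4-p09 (g8)'s (d)-lev cells in `LevLabelledBoxSum ℓ₁ ℓ₂` currency (★ `…LevLabelledCellsSplitH` ∕ `…LevLabelledCellsGlued`; G3 as a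
HYPOTHESIS until its cell lands) and F0P3a-p01 (g36)'s two-token box-sum `LevLabelledBoxSum ℓ₁ ℓ₂` (★ p860066) as a HYPOTHESIS).  2026-09-04.
-/
import Summits.HodgeConjecture.HodgeConjecture.Theorems.F0P3cDyRamLevLabelledCellsSplitH         -- ★ (LH4-p09 (g8)) (d)-lev cells core∕T1∕T2∕T3∕H in `LevLabelledBoxSum` currency
import Summits.HodgeConjecture.HodgeConjecture.Theorems.F0P3cDyRamLevLabelledCellsGlued          -- ★ (LH4-p09 (g8)) (d)-lev cells G1∕G2
import Summits.HodgeConjecture.HodgeConjecture.Theorems.F0P3cDyRamLevLabelledBoxSumDefs          -- ★ p860066∕p860094 (F0P3a-p01 (g36)): `LevLabelledBoxSum ℓ₁ ℓ₂`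
import Summits.HodgeConjecture.HodgeConjecture.Theorems.F0P3cDyRamLabelledKappaStrataPartition   -- ★ p859743 (this seat): the label-cut partition + off-shape vanishing
import Summits.HodgeConjecture.HodgeConjecture.Theorems.F0P3cDyRamKappaCountTypeZeroSigned      -- ★ p857082 TRUNK (for its tool opens: glue witnesses' letters, `normSign_one_add_eq_one`, …)
import HarnessLib

/-!
# Crux `H413`, line LH4 «(D-RAM) FOUR-FRAME» — (d)-lev PART 4: THE TWO-TOKEN LABELLED TRUNK OF THE LEVEL LAWS, ASSEMBLED MODULO `LevLabelledBoxSum ℓ₁ ℓ₂`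

`labelledTrunk_lev_of_boxSum (hbox : LevLabelledBoxSum ℓ₁ ℓ₂) (hG3cell) …` : for a wild datum, an element datum at `N₀` under the fence `2d ≤ nᵢ + 1`, levels `ℓ₁ ≤ 2`,
`ℓ₂ ≤ nᵢ`, the corner exclusion, `T = diag(α, β, 1)`, `2k + d = Σn + 2`, slot `i`, three σ-fixed glue witnesses (trunk-shaped guards):
`Σᶠ_{M ∈ 𝓛₀(T), dualisable, diag(α−1,β−1,0)M ⊆ ϖ^{ℓ₁}M ∧ diag((α−1)²,(β−1)²,0)M ⊆ ϖ^{ℓ₂}M} κ₀,ᵢ(M)·w(M) = WTOK · (q^{k−x} − q^{k−max(x, B′+y)}) ∕ (q − 1)` — the right-hand side of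
★ p860066 divided by `q − 1`, `WTOK` = ★ p857082's witness token table; the per-schedule conversion to `ampl(q, k − kl d, B − bl d)∕4` and the four law heads
(`stub_law_levLo ∕ levHi ∕ levCleanLo ∕ levCleanHi` via ★ p859848) are (d)-lev PART 5.  PROOF = ★ p860129's with the two-token label: partition ★ p859743 (generic `Q`),
cells ★ LH4-p09 `cell_core ∕ cell_T1–T3 ∕ cell_G1 ∕ cell_G2 ∕ cell_H` + the hypothesis `hG3cell` (the apex-3 glued cell, LH4-p09's next file), off-shape ★
`finsum_stratum_sep_eq_zero_of_not_shape`, the conductor side conditions `hω0∕1∕2` verbatim, box-sum `hbox`, division by `q − 1`.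

HONEST LABEL: helper lane (`--supports stmt-HodgeConjecture-24833`), count-neutral; CONDITIONAL on `LevLabelledBoxSum ℓ₁ ℓ₂` (F0P3a-p01's (c)) and on the G3 cell
hypothesis; pays no tier-0 row; HC_CM is proved only modulo the 7 printed citations (2 remaining named inputs: hLiu418 = stmt-HodgeConjecture-24832, h413 =
stmt-HodgeConjecture-24833) until rung 0 closes.

## References (NEVER `[KR2]`)
* [Kottwitz1986BaseChangeUnits] R. E. Kottwitz, *Base change for unit elements of Hecke algebras*, Compositio Math. 60 (1986), §1 pp. 240–241.
* [Rogawski1990] J. D. Rogawski, *Automorphic Representations of Unitary Groups in Three Variables*, Ann. of Math. Stud. 123 (1990), §4.9 Prop. 4.9.1 (a) p. 55, §4.10 p. 58.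
* [LanglandsShelstad1987] R. P. Langlands, D. Shelstad, *On the definition of transfer factors*, Math. Ann. 278 (1987), §3.
* [Serre1979] J.-P. Serre, *Local Fields*, GTM 67 (1979), Ch. V §3 Prop. 5, Cor. 3.
-/

set_option autoImplicit false

noncomputable section

namespace Summit.HodgeConjecture.HodgeConjecture.Cruxes.H413.F0P3cDyRamLevLabelledTrunkOfBoxSum

open Finset
open Literature.NumberTheory.Automorphic Literature.NumberTheory.Automorphic.HermitianLattice
open Literature.NumberTheory.Automorphic.UnitaryLatticeTree Literature.NumberTheory.Automorphic.UnitaryThreeFourFrame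
open Literature.NumberTheory.LocalFields Literature.NumberTheory.LocalFields.WildQuadraticDatum
open Summit.HodgeConjecture.HodgeConjecture.Cruxes.H413.F0P3cDyRamFourFrameLawDefsR (shiftR)
open Summit.HodgeConjecture.HodgeConjecture.Cruxes.H413.F0P3cDyRamDiagonalTorusDefs
open Summit.HodgeConjecture.HodgeConjecture.Cruxes.H413.F0P3cDyRamDiagonalStrataDefs
open Summit.HodgeConjecture.HodgeConjecture.Cruxes.H413.F0P3cDyRamDiagonalKappaCountDefs
open Summit.HodgeConjecture.HodgeConjecture.Cruxes.H413.F0P3cDyRamStrataPartition (finsum_mem_eq_sum_box_finsum_mem_hasAxis)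
open Summit.HodgeConjecture.HodgeConjecture.Cruxes.H413.F0P3cDyRamDiagonalStrataAxis (exists_hasAxis hasAxis_unique)
open Summit.HodgeConjecture.HodgeConjecture.Cruxes.H413.F0P3cDyRamDiagonalStrataShapes (hasAxis_shapes)
open Summit.HodgeConjecture.HodgeConjecture.Cruxes.H413.F0P3cDyRamDiagonalKappaSplitCountSockets
open Summit.HodgeConjecture.HodgeConjecture.Cruxes.H413.F0P3cDyRamDiagonalKappaGluedSocket (finsum_kappaCount_mul_stabiliserWeight_hasAxis_G1)
open Summit.HodgeConjecture.HodgeConjecture.Cruxes.H413.F0P3cDyRamDiagonalKappaGluedRotations (finsum_kappaCount_mul_stabiliserWeight_hasAxis_G2 finsum_kappaCount_mul_stabiliserWeight_hasAxis_G3)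
open Summit.HodgeConjecture.HodgeConjecture.Cruxes.H413.F0P3cDyRamDiagonalKappaCoreHangingSocket (finsum_kappaCount_mul_stabiliserWeight_hasAxis_H)
open Summit.HodgeConjecture.HodgeConjecture.Cruxes.H413.F0P3cDyRamElementDatumParity
open Summit.HodgeConjecture.HodgeConjecture.Cruxes.H413.F0P3cDyRamStableCountTypeZero (v_diag_eq_one diag_regular finite_normalisedStableLattices)
open Summit.HodgeConjecture.HodgeConjecture.Cruxes.H413.F0P3cDyRamGlueUnitRationalityDepth (exists_fixed_v_add_glueUnit_le_iff)
open Summit.HodgeConjecture.HodgeConjecture.Cruxes.H413.F0P3cDyRamDiagonalPermutation (isElementDatum_swap isElementDatum_rescale)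
open Summit.HodgeConjecture.HodgeConjecture.Cruxes.H413.F0P3cDyRamKappaAssemblyTools
open Summit.HodgeConjecture.HodgeConjecture.Cruxes.H413.F0P3cDyRamDiagonalKappaCoreHangingClass (two_le_d_of_v_two_lt_one)
open scoped Valued WithZero Matrix MatrixGroups
open Summit.HodgeConjecture.HodgeConjecture.Cruxes.H413.F0P3cDyRamKappaCountBoxSum (sum_box_kappa_eq_typeZero)
open Summit.HodgeConjecture.HodgeConjecture.Cruxes.H413.F0P3cDyRamFourFrameCensusDefs
open Summit.HodgeConjecture.HodgeConjecture.Cruxes.H413.F0P3cDyRamLabelledKappaStrataPartition (finsum_mem_sep_eq_sum_box_finsum_stratum_sep finsum_stratum_sep_eq_zero_of_not_shape)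
open Summit.HodgeConjecture.HodgeConjecture.Cruxes.H413.F0P3cDyRamLevLabelledCellsSplitH (cell_core cell_T1 cell_T2 cell_T3 cell_H)
open Summit.HodgeConjecture.HodgeConjecture.Cruxes.H413.F0P3cDyRamLevLabelledCellsGlued (cell_G1 cell_G2)
open Summit.HodgeConjecture.HodgeConjecture.Cruxes.H413.F0P3cDyRamLevLabelledBoxSumDefs (LevLabelledBoxSum)


/-- **THE TWO-TOKEN LABELLED TRUNK OF THE LEVEL LAWS MODULO `LevLabelledBoxSum ℓ₁ ℓ₂` AND THE G3 CELL** (see the module docstring).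
[cite: Kottwitz1986BaseChangeUnits, §1 pp. 240–241] [cite: Rogawski1990, §4.9 Prop. 4.9.1 (a) p. 55; §4.10 p. 58] [cite: LanglandsShelstad1987, §3] [cite: Serre1979, Ch. V §3 Prop. 5, Cor. 3] -/
theorem labelledTrunk_lev_of_boxSum {ℓ₁ ℓ₂ : ℕ} (hbox : LevLabelledBoxSum ℓ₁ ℓ₂)
    {K : Type} [Field K] [Valued K ℤᵐ⁰] [CompleteSpace K] [Fintype 𝓀[K]] {σ : K →+* K} {ϖ : K} {d t : ℕ} (hD : IsRamifiedQuadraticDatum σ ϖ d t)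
    (h2 : Valued.v (2 : K) < 1) {α β : K} {n₁ n₂ n₃ : ℕ} (hE : IsElementDatum σ ϖ (depthOfRecord d) α β n₁ n₂ n₃)
    (hfence : 2 * d ≤ n₁ + 1 ∧ 2 * d ≤ n₂ + 1 ∧ 2 * d ≤ n₃ + 1) (hℓ₁ : ℓ₁ ≤ 2) (hℓ₂ : ℓ₂ ≤ n₁ ∧ ℓ₂ ≤ n₂ ∧ ℓ₂ ≤ n₃)
    (hcorner : d % 2 = 0 → ℓ₁ = 1 → d + 1 ≤ ℓ₂) (T : GL (Fin 3) K) (hT : (T : Matrix (Fin 3) (Fin 3) K) = Matrix.diagonal ![α, β, 1]) (k : ℕ) (hk : 2 * k + d = n₁ + n₂ + n₃ + 2)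
    (i : Fin 3)
    {f₀ f₁ f₂ : K} (hσf₀ : σ f₀ = f₀) (hσf₁ : σ f₁ = f₁) (hσf₂ : σ f₂ = f₂)
    (hf₀ : n₂ = n₃ → n₂ ≤ n₁ → Valued.v (f₀ + (β - 1) / (α - 1)) ≤ Valued.v ϖ ^ (n₁ - d + 1))
    (hf₁ : n₁ = n₃ → n₁ ≤ n₂ → Valued.v (f₁ + (α - 1) / (β - 1)) ≤ Valued.v ϖ ^ (n₂ - d + 1))
    (hf₂' : n₂ = n₁ → n₂ ≤ n₃ → Valued.v (f₂ + (β * α⁻¹ - 1) / (α⁻¹ - 1)) ≤ Valued.v ϖ ^ (n₃ - d + 1))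
    (hG3cell : ∀ ρ s, 1 ≤ ρ → 1 ≤ s →
      ∑ᶠ M ∈ {M | M ∈ stratum σ ϖ T ![2 * ρ + s, 2 * ρ + s, 2 * ρ] ∧
          (LatticeInLevel ϖ ℓ₁ (Matrix.diagonal ![α - 1, β - 1, 0]) M ∧ LatticeInLevel ϖ ℓ₂ (Matrix.diagonal ![(α - 1) * (α - 1), (β - 1) * (β - 1), 0]) M)},
          (kappaCount σ ϖ 0 i M : ℚ) * stabiliserWeight σ M =
        (if 2 ∣ s ∧ 2 * ρ ≤ min n₁ n₂ ∧ 2 * ρ + s ≤ n₃ ∧ 2 * ρ + ℓ₁ ≤ n₂ ∧ 2 * ρ + s + ℓ₁ ≤ n₃ ∧ 2 * ρ + ℓ₂ ≤ 2 * n₂ then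
            (![0, 0, (normSign σ (-1 : K) : ℚ) * (Fintype.card 𝓀[K] : ℚ) ^ (2 * ρ + s / 2 - 1) *
                ((if 2 * d ≤ s then (Fintype.card 𝓀[K] : ℚ) - 1 else 0) - (if s + 2 = 2 * d then 1 else 0))] : Fin 3 → ℚ) i
          else 0) +
        (if 2 ∣ s ∧ n₁ = n₂ ∧ n₃ = n₁ + s ∧ n₁ < 2 * ρ + ℓ₁ ∧ ℓ₁ + ρ ≤ n₁ ∧ ℓ₁ + 2 * ρ - n₁ ≤ n₁ - d + 1 ∧ 2 * ρ + ℓ₂ ≤ 2 * n₁ then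
            (![if 2 * d ≤ ℓ₁ + 2 * ρ - n₁ + 1 then (normSign σ f₂ : ℚ) else 0,
               if 2 * d ≤ ℓ₁ + 2 * ρ - n₁ + 1 then (normSign σ (-1 : K) : ℚ) * normSign σ f₂ * normSign σ (1 + f₂) else 0,
               if 2 * d ≤ s + (ℓ₁ + 2 * ρ - n₁ + 1) then (normSign σ (-1 : K) : ℚ) * normSign σ (1 + f₂) else 0] : Fin 3 → ℚ) i *
              (Fintype.card 𝓀[K] : ℚ) ^ (2 * ρ + s / 2 - (ℓ₁ + 2 * ρ - n₁ + 1) / 2)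
          else 0)) :
    ∑ᶠ M ∈ {M : Submodule 𝒪[K] (Fin 3 → K) | M ∈ normalisedStableLattices T ∧ IsDualisableLattice σ ϖ M ∧
            (LatticeInLevel ϖ ℓ₁ (Matrix.diagonal ![α - 1, β - 1, 0]) M ∧
              LatticeInLevel ϖ ℓ₂ (Matrix.diagonal ![(α - 1) * (α - 1), (β - 1) * (β - 1), 0]) M)},
        (kappaCount σ ϖ 0 i M : ℚ) * stabiliserWeight σ M =
      (if n₁ = n₂ ∧ n₂ = n₃ then ((((![normSign σ (-(1 + f₀)), normSign σ f₀ * normSign σ (-(1 + f₀)), normSign σ f₀] : Fin 3 → ℤ) i : ℤ) : ℚ))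
      else if n₂ = n₃ then (![![(normSign σ (-1 : K) : ℚ) * normSign σ (1 + f₀), (normSign σ (-1 : K) : ℚ) * normSign σ f₀ * normSign σ (1 + f₀), (normSign σ f₀ : ℚ)],
         ![(normSign σ (-1 : K) : ℚ) * normSign σ f₁ * normSign σ (1 + f₁), (normSign σ (-1 : K) : ℚ) * normSign σ (1 + f₁), (normSign σ f₁ : ℚ)],
         ![(normSign σ f₂ : ℚ), (normSign σ (-1 : K) : ℚ) * normSign σ f₂ * normSign σ (1 + f₂), (normSign σ (-1 : K) : ℚ) * normSign σ (1 + f₂)]] : Fin 3 → Fin 3 → ℚ) 0 i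
      else if n₁ = n₃ then (![![(normSign σ (-1 : K) : ℚ) * normSign σ (1 + f₀), (normSign σ (-1 : K) : ℚ) * normSign σ f₀ * normSign σ (1 + f₀), (normSign σ f₀ : ℚ)],
         ![(normSign σ (-1 : K) : ℚ) * normSign σ f₁ * normSign σ (1 + f₁), (normSign σ (-1 : K) : ℚ) * normSign σ (1 + f₁), (normSign σ f₁ : ℚ)],
         ![(normSign σ f₂ : ℚ), (normSign σ (-1 : K) : ℚ) * normSign σ f₂ * normSign σ (1 + f₂), (normSign σ (-1 : K) : ℚ) * normSign σ (1 + f₂)]] : Fin 3 → Fin 3 → ℚ) 1 i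
      else (![![(normSign σ (-1 : K) : ℚ) * normSign σ (1 + f₀), (normSign σ (-1 : K) : ℚ) * normSign σ f₀ * normSign σ (1 + f₀), (normSign σ f₀ : ℚ)],
         ![(normSign σ (-1 : K) : ℚ) * normSign σ f₁ * normSign σ (1 + f₁), (normSign σ (-1 : K) : ℚ) * normSign σ (1 + f₁), (normSign σ f₁ : ℚ)],
         ![(normSign σ f₂ : ℚ), (normSign σ (-1 : K) : ℚ) * normSign σ f₂ * normSign σ (1 + f₂), (normSign σ (-1 : K) : ℚ) * normSign σ (1 + f₂)]] : Fin 3 → Fin 3 → ℚ) 2 i) *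
        (((Fintype.card 𝓀[K] : ℚ) ^ (k - max ℓ₁ ((ℓ₂ + 1) / 2 - d / 2 + (ℓ₁ + 1 - d % 2) / 2)) -
            (Fintype.card 𝓀[K] : ℚ) ^ (k - max (max ℓ₁ ((ℓ₂ + 1) / 2 - d / 2 + (ℓ₁ + 1 - d % 2) / 2))
              ((((![n₁, n₂, n₃] : Fin 3 → ℕ) i + 2 * (d % 2) + 2 - 3 * d) / 2) + 2 * ((ℓ₁ + 1 - d % 2) / 2)))) /
          ((Fintype.card 𝓀[K] : ℚ) - 1)) := by
  have hD' := hD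
  obtain ⟨hσ, hvσ, hϖ, hfix, hdϖ, hd1, -⟩ := hD'
  have hd2 : 2 ≤ d := two_le_d_of_v_two_lt_one hD h2
  have hN₀ : d ≤ depthOfRecord d := by unfold depthOfRecord; split_ifs <;> omega
  have hϖ1 : Valued.v ϖ ≤ 1 := by rw [hϖ, ← WithZero.exp_zero, WithZero.exp_le_exp]; norm_num
  have hE' := hE
  obtain ⟨hαn, hβn, hαβ, hα1, hβ1, h₁, h₂, h₃, hN₁, hN₂, hN₃⟩ := hE'
  -- (1)–(2) the label-cut summation set is the box sum of its label-cut strata (★ p859743)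
  rw [finsum_mem_sep_eq_sum_box_finsum_stratum_sep hD hE T hT
    (fun M => LatticeInLevel ϖ ℓ₁ (Matrix.diagonal ![α - 1, β - 1, 0]) M ∧ LatticeInLevel ϖ ℓ₂ (Matrix.diagonal ![(α - 1) * (α - 1), (β - 1) * (β - 1), 0]) M)
    (fun M => (kappaCount σ ϖ 0 i M : ℚ) * stabiliserWeight σ M)]
  -- (3) the glue witnesses of the three feet are BINDERS here (foot 0 ∕ H share `(β−1)∕(α−1)`; feet 1, 2 live on the swapped ∕ rescaled element data)
  have hα0 : α ≠ 0 := fun h => by rw [h, zero_mul] at hαn; exact zero_ne_one hαn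
  have hf₂ : n₂ = n₁ → n₂ ≤ n₃ → Valued.v (f₂ + (β - α) / (1 - α)) ≤ Valued.v ϖ ^ (n₃ - d + 1) := by
    intro h21 h23
    -- the glue unit of the rescaled datum: `(βα⁻¹ − 1)∕(α⁻¹ − 1) = (β − α)∕(1 − α)` (as in ★ `…KappaGluedRotations`)
    have key : (β * α⁻¹ - 1) / (α⁻¹ - 1) = (β - α) / (1 - α) := by
      have h1α : (1 : K) - α ≠ 0 := sub_ne_zero.2 (Ne.symm hα1)
      have hi : α⁻¹ - 1 = (1 - α) * α⁻¹ := by field_simp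
      have hn : β * α⁻¹ - 1 = (β - α) * α⁻¹ := by field_simp
      rw [hi, hn, mul_div_mul_right _ _ (inv_ne_zero hα0)]
    rw [← key]; exact hf₂' h21 h23
  -- the «apex with excess ≥ 2d» guards: there the glue witness is `2d`-deep, so `ω(1 + f) = 1`
  have hvϖ0 : Valued.v ϖ ≠ 0 := by rw [hϖ]; exact WithZero.coe_ne_zero
  have hdeep : ∀ {f g : K} {e m : ℕ}, Valued.v (f + g) ≤ Valued.v ϖ ^ e → Valued.v g = Valued.v ϖ ^ m → 2 * d ≤ e → 2 * d ≤ m →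
      Valued.v f ≤ Valued.v ϖ ^ (2 * d) := by
    intro f g e m hfg hg he hm
    have ef : f = (f + g) - g := by ring
    rw [ef]
    refine (Valuation.map_sub _ _ _).trans (max_le ?_ ?_)
    · exact hfg.trans (pow_le_pow_right_of_le_one' hϖ1 he)
    · rw [hg]; exact pow_le_pow_right_of_le_one' hϖ1 hm
  have hβ0 : β ≠ 0 := fun h => by rw [h, zero_mul] at hβn; exact zero_ne_one hβn
  have hω0 : i = 0 → n₂ = n₃ → n₂ + 2 * d ≤ n₁ →
      (![![(normSign σ (-1 : K) : ℚ) * normSign σ (1 + f₀), (normSign σ (-1 : K) : ℚ) * normSign σ f₀ * normSign σ (1 + f₀), (normSign σ f₀ : ℚ)],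
         ![(normSign σ (-1 : K) : ℚ) * normSign σ f₁ * normSign σ (1 + f₁), (normSign σ (-1 : K) : ℚ) * normSign σ (1 + f₁), (normSign σ f₁ : ℚ)],
         ![(normSign σ f₂ : ℚ), (normSign σ (-1 : K) : ℚ) * normSign σ f₂ * normSign σ (1 + f₂), (normSign σ (-1 : K) : ℚ) * normSign σ (1 + f₂)]] : Fin 3 → Fin 3 → ℚ) 0 0 =
        (normSign σ (-1 : K) : ℚ) := by
    intro _ h23 hle
    have hg : Valued.v ((β - 1) / (α - 1)) = Valued.v ϖ ^ (n₁ - n₂) := by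
      rw [map_div₀, h₁, h₂, div_eq_iff (pow_ne_zero _ hvϖ0), ← pow_add, Nat.sub_add_cancel (by omega)]
    have h1 := normSign_one_add_eq_one hD hσf₀ (hdeep (hf₀ h23 (by omega)) hg (by omega) (by omega))
    show (normSign σ (-1 : K) : ℚ) * normSign σ (1 + f₀) = _
    rw [h1, Int.cast_one, mul_one]
  have hω1 : i = 1 → n₁ = n₃ → n₁ + 2 * d ≤ n₂ →
      (![![(normSign σ (-1 : K) : ℚ) * normSign σ (1 + f₀), (normSign σ (-1 : K) : ℚ) * normSign σ f₀ * normSign σ (1 + f₀), (normSign σ f₀ : ℚ)],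
         ![(normSign σ (-1 : K) : ℚ) * normSign σ f₁ * normSign σ (1 + f₁), (normSign σ (-1 : K) : ℚ) * normSign σ (1 + f₁), (normSign σ f₁ : ℚ)],
         ![(normSign σ f₂ : ℚ), (normSign σ (-1 : K) : ℚ) * normSign σ f₂ * normSign σ (1 + f₂), (normSign σ (-1 : K) : ℚ) * normSign σ (1 + f₂)]] : Fin 3 → Fin 3 → ℚ) 1 1 =
        (normSign σ (-1 : K) : ℚ) := by
    intro _ h13 hle
    have hg : Valued.v ((α - 1) / (β - 1)) = Valued.v ϖ ^ (n₂ - n₁) := by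
      rw [map_div₀, h₁, h₂, div_eq_iff (pow_ne_zero _ hvϖ0), ← pow_add, Nat.sub_add_cancel (by omega)]
    have h1 := normSign_one_add_eq_one hD hσf₁ (hdeep (hf₁ h13 (by omega)) hg (by omega) (by omega))
    show (normSign σ (-1 : K) : ℚ) * normSign σ (1 + f₁) = _
    rw [h1, Int.cast_one, mul_one]
  have hω2 : i = 2 → n₁ = n₂ → n₁ + 2 * d ≤ n₃ →
      (![![(normSign σ (-1 : K) : ℚ) * normSign σ (1 + f₀), (normSign σ (-1 : K) : ℚ) * normSign σ f₀ * normSign σ (1 + f₀), (normSign σ f₀ : ℚ)],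
         ![(normSign σ (-1 : K) : ℚ) * normSign σ f₁ * normSign σ (1 + f₁), (normSign σ (-1 : K) : ℚ) * normSign σ (1 + f₁), (normSign σ f₁ : ℚ)],
         ![(normSign σ f₂ : ℚ), (normSign σ (-1 : K) : ℚ) * normSign σ f₂ * normSign σ (1 + f₂), (normSign σ (-1 : K) : ℚ) * normSign σ (1 + f₂)]] : Fin 3 → Fin 3 → ℚ) 2 2 =
        (normSign σ (-1 : K) : ℚ) := by
    intro _ h12 hle
    have hg : Valued.v ((β - α) / (1 - α)) = Valued.v ϖ ^ (n₃ - n₂) := by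
      rw [map_div₀, Valuation.map_sub_swap _ β α, h₃, Valuation.map_sub_swap _ 1 α, h₂, div_eq_iff (pow_ne_zero _ hvϖ0), ← pow_add,
        Nat.sub_add_cancel (by omega)]
    have h1 := normSign_one_add_eq_one hD hσf₂ (hdeep (hf₂ h12.symm (by omega)) hg (by omega) (by omega))
    show (normSign σ (-1 : K) : ℚ) * normSign σ (1 + f₂) = _
    rw [h1, Int.cast_one, mul_one]
  -- the foot-2 socket ★ `…_hasAxis_G3` is typed `n₂`-based (`n₂ = n₁`, `min n₂ n₁`, `⌈(2ρ−n₂)∕2⌉`); `hbox` reads it `n₁`-based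
  -- off the ★ B3 shape list a label-cut stratum is `0` (★ p859743)
  have hzero : ∀ a : Fin 3 → ℕ, ¬ ((a = ![0, 0, 0]) ∨
      (∃ s, 2 ∣ s ∧ 2 ≤ s ∧ (a = ![0, s, s] ∨ a = ![s, 0, s] ∨ a = ![s, s, 0])) ∨
      (∃ ρ s, 1 ≤ ρ ∧ 2 ∣ s ∧ 2 ≤ s ∧ (a = ![2 * ρ, 2 * ρ + s, 2 * ρ + s] ∨ a = ![2 * ρ + s, 2 * ρ, 2 * ρ + s] ∨ a = ![2 * ρ + s, 2 * ρ + s, 2 * ρ])) ∨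
      (∃ ρ, 1 ≤ ρ ∧ a = ![2 * ρ, 2 * ρ, 2 * ρ])) →
      (fun a => ∑ᶠ M ∈ {M | M ∈ stratum σ ϖ T a ∧ (LatticeInLevel ϖ ℓ₁ (Matrix.diagonal ![α - 1, β - 1, 0]) M ∧ LatticeInLevel ϖ ℓ₂ (Matrix.diagonal ![(α - 1) * (α - 1), (β - 1) * (β - 1), 0]) M)},
        (kappaCount σ ϖ 0 i M : ℚ) * stabiliserWeight σ M) a = 0 :=
    fun a ha => finsum_stratum_sep_eq_zero_of_not_shape hD T _ _ a ha
  -- (5) the truncated labelled box sum `SqLabelledBoxSum` (LH4-p12 DEFS ★ p859958; proof LH4-p10) fed with the cells in its currency ((d) PARTS 1–3)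
  obtain ⟨hp1, hp2, hp3⟩ := depth_mod_two_eq_of_isElementDatum hD hE hN₀
  unfold LevLabelledBoxSum at hbox
  have key := hbox (Fintype.card 𝓀[K]) hd2 (isoceles_of_isElementDatum hD hE) hfence hℓ₁ hℓ₂ hcorner hp1 hp2 hp3 le_rfl hk i
    ((normSign σ (-1 : K) : ℚ))
    ((((![normSign σ (-(1 + f₀)), normSign σ f₀ * normSign σ (-(1 + f₀)), normSign σ f₀] : Fin 3 → ℤ) i : ℤ) : ℚ))
    (![![(normSign σ (-1 : K) : ℚ) * normSign σ (1 + f₀), (normSign σ (-1 : K) : ℚ) * normSign σ f₀ * normSign σ (1 + f₀), (normSign σ f₀ : ℚ)],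
       ![(normSign σ (-1 : K) : ℚ) * normSign σ f₁ * normSign σ (1 + f₁), (normSign σ (-1 : K) : ℚ) * normSign σ (1 + f₁), (normSign σ f₁ : ℚ)],
       ![(normSign σ f₂ : ℚ), (normSign σ (-1 : K) : ℚ) * normSign σ f₂ * normSign σ (1 + f₂), (normSign σ (-1 : K) : ℚ) * normSign σ (1 + f₂)]])
    hω0 hω1 hω2
    (fun a => ∑ᶠ M ∈ {M | M ∈ stratum σ ϖ T a ∧ (LatticeInLevel ϖ ℓ₁ (Matrix.diagonal ![α - 1, β - 1, 0]) M ∧ LatticeInLevel ϖ ℓ₂ (Matrix.diagonal ![(α - 1) * (α - 1), (β - 1) * (β - 1), 0]) M)},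
      (kappaCount σ ϖ 0 i M : ℚ) * stabiliserWeight σ M)
    (cell_core hD hE hT i ℓ₁ ℓ₂)
    (fun s hs => cell_T1 hD hE hT hd2 hfence hℓ₁ hℓ₂ s hs i)
    (fun s hs => cell_T2 hD hE hT hd2 hfence hℓ₁ hℓ₂ s hs i)
    (fun s hs => cell_T3 hD hE hT hd2 hfence hℓ₁ hℓ₂ s hs i)
    (fun ρ s hρ hs => cell_G1 hD h2 hE hN₀ hT hd2 hfence hℓ₁ hℓ₂ ρ s hρ hs i f₀ hσf₀ hf₀)
    (fun ρ s hρ hs => cell_G2 hD h2 hE hN₀ hT hd2 hfence hℓ₁ hℓ₂ ρ s hρ hs i f₁ hσf₁ hf₁)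
    hG3cell
    (fun ρ hρ => cell_H hD h2 hE hN₀ hT hd2 hfence hℓ₁ hℓ₂ ρ hρ i f₀ hσf₀ hf₀)
    hzero
  -- (6) divide by `q − 1`
  set q : ℕ := Fintype.card 𝓀[K] with hq_def
  have hq1 : (1 : ℚ) < q := by exact_mod_cast (Fintype.one_lt_card : 1 < Fintype.card 𝓀[K])
  have hq1' : (q : ℚ) - 1 ≠ 0 := by linarith
  rw [← mul_div_assoc, eq_div_iff hq1', mul_comm]
  exact key

/-- **THE SAME TRUNK AT A GENERIC DEPTH PARAMETER `N₀ ≥ d`** (ED. 2, append-only: the level laws of record read the element datum at `depthOfRecord d` for the lo∕hi rows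
and at `n0DerivedOfRecord d` for the clean rows — ★ p859848 is generic in `N₀`; statement and proof = `labelledTrunk_lev_of_boxSum` with `depthOfRecord d ↦ N₀`, `hN₀ : d ≤ N₀` a binder).
[cite: Kottwitz1986BaseChangeUnits, §1 pp. 240–241] [cite: Rogawski1990, §4.9 Prop. 4.9.1 (a) p. 55; §4.10 p. 58] [cite: LanglandsShelstad1987, §3] [cite: Serre1979, Ch. V §3 Prop. 5, Cor. 3] -/
theorem labelledTrunk_lev_at_of_boxSum {ℓ₁ ℓ₂ : ℕ} (hbox : LevLabelledBoxSum ℓ₁ ℓ₂)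
    {K : Type} [Field K] [Valued K ℤᵐ⁰] [CompleteSpace K] [Fintype 𝓀[K]] {σ : K →+* K} {ϖ : K} {d t : ℕ} (hD : IsRamifiedQuadraticDatum σ ϖ d t)
    (h2 : Valued.v (2 : K) < 1) {α β : K} {n₁ n₂ n₃ : ℕ} {N₀ : ℕ} (hN₀ : d ≤ N₀) (hE : IsElementDatum σ ϖ N₀ α β n₁ n₂ n₃)
    (hfence : 2 * d ≤ n₁ + 1 ∧ 2 * d ≤ n₂ + 1 ∧ 2 * d ≤ n₃ + 1) (hℓ₁ : ℓ₁ ≤ 2) (hℓ₂ : ℓ₂ ≤ n₁ ∧ ℓ₂ ≤ n₂ ∧ ℓ₂ ≤ n₃)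
    (hcorner : d % 2 = 0 → ℓ₁ = 1 → d + 1 ≤ ℓ₂) (T : GL (Fin 3) K) (hT : (T : Matrix (Fin 3) (Fin 3) K) = Matrix.diagonal ![α, β, 1]) (k : ℕ) (hk : 2 * k + d = n₁ + n₂ + n₃ + 2)
    (i : Fin 3)
    {f₀ f₁ f₂ : K} (hσf₀ : σ f₀ = f₀) (hσf₁ : σ f₁ = f₁) (hσf₂ : σ f₂ = f₂)
    (hf₀ : n₂ = n₃ → n₂ ≤ n₁ → Valued.v (f₀ + (β - 1) / (α - 1)) ≤ Valued.v ϖ ^ (n₁ - d + 1))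
    (hf₁ : n₁ = n₃ → n₁ ≤ n₂ → Valued.v (f₁ + (α - 1) / (β - 1)) ≤ Valued.v ϖ ^ (n₂ - d + 1))
    (hf₂' : n₂ = n₁ → n₂ ≤ n₃ → Valued.v (f₂ + (β * α⁻¹ - 1) / (α⁻¹ - 1)) ≤ Valued.v ϖ ^ (n₃ - d + 1))
    (hG3cell : ∀ ρ s, 1 ≤ ρ → 1 ≤ s →
      ∑ᶠ M ∈ {M | M ∈ stratum σ ϖ T ![2 * ρ + s, 2 * ρ + s, 2 * ρ] ∧
          (LatticeInLevel ϖ ℓ₁ (Matrix.diagonal ![α - 1, β - 1, 0]) M ∧ LatticeInLevel ϖ ℓ₂ (Matrix.diagonal ![(α - 1) * (α - 1), (β - 1) * (β - 1), 0]) M)},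
          (kappaCount σ ϖ 0 i M : ℚ) * stabiliserWeight σ M =
        (if 2 ∣ s ∧ 2 * ρ ≤ min n₁ n₂ ∧ 2 * ρ + s ≤ n₃ ∧ 2 * ρ + ℓ₁ ≤ n₂ ∧ 2 * ρ + s + ℓ₁ ≤ n₃ ∧ 2 * ρ + ℓ₂ ≤ 2 * n₂ then
            (![0, 0, (normSign σ (-1 : K) : ℚ) * (Fintype.card 𝓀[K] : ℚ) ^ (2 * ρ + s / 2 - 1) *
                ((if 2 * d ≤ s then (Fintype.card 𝓀[K] : ℚ) - 1 else 0) - (if s + 2 = 2 * d then 1 else 0))] : Fin 3 → ℚ) i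
          else 0) +
        (if 2 ∣ s ∧ n₁ = n₂ ∧ n₃ = n₁ + s ∧ n₁ < 2 * ρ + ℓ₁ ∧ ℓ₁ + ρ ≤ n₁ ∧ ℓ₁ + 2 * ρ - n₁ ≤ n₁ - d + 1 ∧ 2 * ρ + ℓ₂ ≤ 2 * n₁ then
            (![if 2 * d ≤ ℓ₁ + 2 * ρ - n₁ + 1 then (normSign σ f₂ : ℚ) else 0,
               if 2 * d ≤ ℓ₁ + 2 * ρ - n₁ + 1 then (normSign σ (-1 : K) : ℚ) * normSign σ f₂ * normSign σ (1 + f₂) else 0,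
               if 2 * d ≤ s + (ℓ₁ + 2 * ρ - n₁ + 1) then (normSign σ (-1 : K) : ℚ) * normSign σ (1 + f₂) else 0] : Fin 3 → ℚ) i *
              (Fintype.card 𝓀[K] : ℚ) ^ (2 * ρ + s / 2 - (ℓ₁ + 2 * ρ - n₁ + 1) / 2)
          else 0)) :
    ∑ᶠ M ∈ {M : Submodule 𝒪[K] (Fin 3 → K) | M ∈ normalisedStableLattices T ∧ IsDualisableLattice σ ϖ M ∧
            (LatticeInLevel ϖ ℓ₁ (Matrix.diagonal ![α - 1, β - 1, 0]) M ∧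
              LatticeInLevel ϖ ℓ₂ (Matrix.diagonal ![(α - 1) * (α - 1), (β - 1) * (β - 1), 0]) M)},
        (kappaCount σ ϖ 0 i M : ℚ) * stabiliserWeight σ M =
      (if n₁ = n₂ ∧ n₂ = n₃ then ((((![normSign σ (-(1 + f₀)), normSign σ f₀ * normSign σ (-(1 + f₀)), normSign σ f₀] : Fin 3 → ℤ) i : ℤ) : ℚ))
      else if n₂ = n₃ then (![![(normSign σ (-1 : K) : ℚ) * normSign σ (1 + f₀), (normSign σ (-1 : K) : ℚ) * normSign σ f₀ * normSign σ (1 + f₀), (normSign σ f₀ : ℚ)],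
         ![(normSign σ (-1 : K) : ℚ) * normSign σ f₁ * normSign σ (1 + f₁), (normSign σ (-1 : K) : ℚ) * normSign σ (1 + f₁), (normSign σ f₁ : ℚ)],
         ![(normSign σ f₂ : ℚ), (normSign σ (-1 : K) : ℚ) * normSign σ f₂ * normSign σ (1 + f₂), (normSign σ (-1 : K) : ℚ) * normSign σ (1 + f₂)]] : Fin 3 → Fin 3 → ℚ) 0 i
      else if n₁ = n₃ then (![![(normSign σ (-1 : K) : ℚ) * normSign σ (1 + f₀), (normSign σ (-1 : K) : ℚ) * normSign σ f₀ * normSign σ (1 + f₀), (normSign σ f₀ : ℚ)],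
         ![(normSign σ (-1 : K) : ℚ) * normSign σ f₁ * normSign σ (1 + f₁), (normSign σ (-1 : K) : ℚ) * normSign σ (1 + f₁), (normSign σ f₁ : ℚ)],
         ![(normSign σ f₂ : ℚ), (normSign σ (-1 : K) : ℚ) * normSign σ f₂ * normSign σ (1 + f₂), (normSign σ (-1 : K) : ℚ) * normSign σ (1 + f₂)]] : Fin 3 → Fin 3 → ℚ) 1 i
      else (![![(normSign σ (-1 : K) : ℚ) * normSign σ (1 + f₀), (normSign σ (-1 : K) : ℚ) * normSign σ f₀ * normSign σ (1 + f₀), (normSign σ f₀ : ℚ)],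
         ![(normSign σ (-1 : K) : ℚ) * normSign σ f₁ * normSign σ (1 + f₁), (normSign σ (-1 : K) : ℚ) * normSign σ (1 + f₁), (normSign σ f₁ : ℚ)],
         ![(normSign σ f₂ : ℚ), (normSign σ (-1 : K) : ℚ) * normSign σ f₂ * normSign σ (1 + f₂), (normSign σ (-1 : K) : ℚ) * normSign σ (1 + f₂)]] : Fin 3 → Fin 3 → ℚ) 2 i) *
        (((Fintype.card 𝓀[K] : ℚ) ^ (k - max ℓ₁ ((ℓ₂ + 1) / 2 - d / 2 + (ℓ₁ + 1 - d % 2) / 2)) -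
            (Fintype.card 𝓀[K] : ℚ) ^ (k - max (max ℓ₁ ((ℓ₂ + 1) / 2 - d / 2 + (ℓ₁ + 1 - d % 2) / 2))
              ((((![n₁, n₂, n₃] : Fin 3 → ℕ) i + 2 * (d % 2) + 2 - 3 * d) / 2) + 2 * ((ℓ₁ + 1 - d % 2) / 2)))) /
          ((Fintype.card 𝓀[K] : ℚ) - 1)) := by
  have hD' := hD
  obtain ⟨hσ, hvσ, hϖ, hfix, hdϖ, hd1, -⟩ := hD'
  have hd2 : 2 ≤ d := two_le_d_of_v_two_lt_one hD h2
  have hϖ1 : Valued.v ϖ ≤ 1 := by rw [hϖ, ← WithZero.exp_zero, WithZero.exp_le_exp]; norm_num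
  have hE' := hE
  obtain ⟨hαn, hβn, hαβ, hα1, hβ1, h₁, h₂, h₃, hN₁, hN₂, hN₃⟩ := hE'
  -- (1)–(2) the label-cut summation set is the box sum of its label-cut strata (★ p859743)
  rw [finsum_mem_sep_eq_sum_box_finsum_stratum_sep hD hE T hT
    (fun M => LatticeInLevel ϖ ℓ₁ (Matrix.diagonal ![α - 1, β - 1, 0]) M ∧ LatticeInLevel ϖ ℓ₂ (Matrix.diagonal ![(α - 1) * (α - 1), (β - 1) * (β - 1), 0]) M)
    (fun M => (kappaCount σ ϖ 0 i M : ℚ) * stabiliserWeight σ M)]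
  -- (3) the glue witnesses of the three feet are BINDERS here (foot 0 ∕ H share `(β−1)∕(α−1)`; feet 1, 2 live on the swapped ∕ rescaled element data)
  have hα0 : α ≠ 0 := fun h => by rw [h, zero_mul] at hαn; exact zero_ne_one hαn
  have hf₂ : n₂ = n₁ → n₂ ≤ n₃ → Valued.v (f₂ + (β - α) / (1 - α)) ≤ Valued.v ϖ ^ (n₃ - d + 1) := by
    intro h21 h23
    -- the glue unit of the rescaled datum: `(βα⁻¹ − 1)∕(α⁻¹ − 1) = (β − α)∕(1 − α)` (as in ★ `…KappaGluedRotations`)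
    have key : (β * α⁻¹ - 1) / (α⁻¹ - 1) = (β - α) / (1 - α) := by
      have h1α : (1 : K) - α ≠ 0 := sub_ne_zero.2 (Ne.symm hα1)
      have hi : α⁻¹ - 1 = (1 - α) * α⁻¹ := by field_simp
      have hn : β * α⁻¹ - 1 = (β - α) * α⁻¹ := by field_simp
      rw [hi, hn, mul_div_mul_right _ _ (inv_ne_zero hα0)]
    rw [← key]; exact hf₂' h21 h23
  -- the «apex with excess ≥ 2d» guards: there the glue witness is `2d`-deep, so `ω(1 + f) = 1`
  have hvϖ0 : Valued.v ϖ ≠ 0 := by rw [hϖ]; exact WithZero.coe_ne_zero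
  have hdeep : ∀ {f g : K} {e m : ℕ}, Valued.v (f + g) ≤ Valued.v ϖ ^ e → Valued.v g = Valued.v ϖ ^ m → 2 * d ≤ e → 2 * d ≤ m →
      Valued.v f ≤ Valued.v ϖ ^ (2 * d) := by
    intro f g e m hfg hg he hm
    have ef : f = (f + g) - g := by ring
    rw [ef]
    refine (Valuation.map_sub _ _ _).trans (max_le ?_ ?_)
    · exact hfg.trans (pow_le_pow_right_of_le_one' hϖ1 he)
    · rw [hg]; exact pow_le_pow_right_of_le_one' hϖ1 hm
  have hβ0 : β ≠ 0 := fun h => by rw [h, zero_mul] at hβn; exact zero_ne_one hβn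
  have hω0 : i = 0 → n₂ = n₃ → n₂ + 2 * d ≤ n₁ →
      (![![(normSign σ (-1 : K) : ℚ) * normSign σ (1 + f₀), (normSign σ (-1 : K) : ℚ) * normSign σ f₀ * normSign σ (1 + f₀), (normSign σ f₀ : ℚ)],
         ![(normSign σ (-1 : K) : ℚ) * normSign σ f₁ * normSign σ (1 + f₁), (normSign σ (-1 : K) : ℚ) * normSign σ (1 + f₁), (normSign σ f₁ : ℚ)],
         ![(normSign σ f₂ : ℚ), (normSign σ (-1 : K) : ℚ) * normSign σ f₂ * normSign σ (1 + f₂), (normSign σ (-1 : K) : ℚ) * normSign σ (1 + f₂)]] : Fin 3 → Fin 3 → ℚ) 0 0 =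
        (normSign σ (-1 : K) : ℚ) := by
    intro _ h23 hle
    have hg : Valued.v ((β - 1) / (α - 1)) = Valued.v ϖ ^ (n₁ - n₂) := by
      rw [map_div₀, h₁, h₂, div_eq_iff (pow_ne_zero _ hvϖ0), ← pow_add, Nat.sub_add_cancel (by omega)]
    have h1 := normSign_one_add_eq_one hD hσf₀ (hdeep (hf₀ h23 (by omega)) hg (by omega) (by omega))
    show (normSign σ (-1 : K) : ℚ) * normSign σ (1 + f₀) = _
    rw [h1, Int.cast_one, mul_one]
  have hω1 : i = 1 → n₁ = n₃ → n₁ + 2 * d ≤ n₂ →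
      (![![(normSign σ (-1 : K) : ℚ) * normSign σ (1 + f₀), (normSign σ (-1 : K) : ℚ) * normSign σ f₀ * normSign σ (1 + f₀), (normSign σ f₀ : ℚ)],
         ![(normSign σ (-1 : K) : ℚ) * normSign σ f₁ * normSign σ (1 + f₁), (normSign σ (-1 : K) : ℚ) * normSign σ (1 + f₁), (normSign σ f₁ : ℚ)],
         ![(normSign σ f₂ : ℚ), (normSign σ (-1 : K) : ℚ) * normSign σ f₂ * normSign σ (1 + f₂), (normSign σ (-1 : K) : ℚ) * normSign σ (1 + f₂)]] : Fin 3 → Fin 3 → ℚ) 1 1 =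
        (normSign σ (-1 : K) : ℚ) := by
    intro _ h13 hle
    have hg : Valued.v ((α - 1) / (β - 1)) = Valued.v ϖ ^ (n₂ - n₁) := by
      rw [map_div₀, h₁, h₂, div_eq_iff (pow_ne_zero _ hvϖ0), ← pow_add, Nat.sub_add_cancel (by omega)]
    have h1 := normSign_one_add_eq_one hD hσf₁ (hdeep (hf₁ h13 (by omega)) hg (by omega) (by omega))
    show (normSign σ (-1 : K) : ℚ) * normSign σ (1 + f₁) = _
    rw [h1, Int.cast_one, mul_one]
  have hω2 : i = 2 → n₁ = n₂ → n₁ + 2 * d ≤ n₃ →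
      (![![(normSign σ (-1 : K) : ℚ) * normSign σ (1 + f₀), (normSign σ (-1 : K) : ℚ) * normSign σ f₀ * normSign σ (1 + f₀), (normSign σ f₀ : ℚ)],
         ![(normSign σ (-1 : K) : ℚ) * normSign σ f₁ * normSign σ (1 + f₁), (normSign σ (-1 : K) : ℚ) * normSign σ (1 + f₁), (normSign σ f₁ : ℚ)],
         ![(normSign σ f₂ : ℚ), (normSign σ (-1 : K) : ℚ) * normSign σ f₂ * normSign σ (1 + f₂), (normSign σ (-1 : K) : ℚ) * normSign σ (1 + f₂)]] : Fin 3 → Fin 3 → ℚ) 2 2 =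
        (normSign σ (-1 : K) : ℚ) := by
    intro _ h12 hle
    have hg : Valued.v ((β - α) / (1 - α)) = Valued.v ϖ ^ (n₃ - n₂) := by
      rw [map_div₀, Valuation.map_sub_swap _ β α, h₃, Valuation.map_sub_swap _ 1 α, h₂, div_eq_iff (pow_ne_zero _ hvϖ0), ← pow_add,
        Nat.sub_add_cancel (by omega)]
    have h1 := normSign_one_add_eq_one hD hσf₂ (hdeep (hf₂ h12.symm (by omega)) hg (by omega) (by omega))
    show (normSign σ (-1 : K) : ℚ) * normSign σ (1 + f₂) = _
    rw [h1, Int.cast_one, mul_one]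
  -- the foot-2 socket ★ `…_hasAxis_G3` is typed `n₂`-based (`n₂ = n₁`, `min n₂ n₁`, `⌈(2ρ−n₂)∕2⌉`); `hbox` reads it `n₁`-based
  -- off the ★ B3 shape list a label-cut stratum is `0` (★ p859743)
  have hzero : ∀ a : Fin 3 → ℕ, ¬ ((a = ![0, 0, 0]) ∨
      (∃ s, 2 ∣ s ∧ 2 ≤ s ∧ (a = ![0, s, s] ∨ a = ![s, 0, s] ∨ a = ![s, s, 0])) ∨
      (∃ ρ s, 1 ≤ ρ ∧ 2 ∣ s ∧ 2 ≤ s ∧ (a = ![2 * ρ, 2 * ρ + s, 2 * ρ + s] ∨ a = ![2 * ρ + s, 2 * ρ, 2 * ρ + s] ∨ a = ![2 * ρ + s, 2 * ρ + s, 2 * ρ])) ∨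
      (∃ ρ, 1 ≤ ρ ∧ a = ![2 * ρ, 2 * ρ, 2 * ρ])) →
      (fun a => ∑ᶠ M ∈ {M | M ∈ stratum σ ϖ T a ∧ (LatticeInLevel ϖ ℓ₁ (Matrix.diagonal ![α - 1, β - 1, 0]) M ∧ LatticeInLevel ϖ ℓ₂ (Matrix.diagonal ![(α - 1) * (α - 1), (β - 1) * (β - 1), 0]) M)},
        (kappaCount σ ϖ 0 i M : ℚ) * stabiliserWeight σ M) a = 0 :=
    fun a ha => finsum_stratum_sep_eq_zero_of_not_shape hD T _ _ a ha
  -- (5) the truncated labelled box sum `SqLabelledBoxSum` (LH4-p12 DEFS ★ p859958; proof LH4-p10) fed with the cells in its currency ((d) PARTS 1–3)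
  obtain ⟨hp1, hp2, hp3⟩ := depth_mod_two_eq_of_isElementDatum hD hE hN₀
  unfold LevLabelledBoxSum at hbox
  have key := hbox (Fintype.card 𝓀[K]) hd2 (isoceles_of_isElementDatum hD hE) hfence hℓ₁ hℓ₂ hcorner hp1 hp2 hp3 le_rfl hk i
    ((normSign σ (-1 : K) : ℚ))
    ((((![normSign σ (-(1 + f₀)), normSign σ f₀ * normSign σ (-(1 + f₀)), normSign σ f₀] : Fin 3 → ℤ) i : ℤ) : ℚ))
    (![![(normSign σ (-1 : K) : ℚ) * normSign σ (1 + f₀), (normSign σ (-1 : K) : ℚ) * normSign σ f₀ * normSign σ (1 + f₀), (normSign σ f₀ : ℚ)],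
       ![(normSign σ (-1 : K) : ℚ) * normSign σ f₁ * normSign σ (1 + f₁), (normSign σ (-1 : K) : ℚ) * normSign σ (1 + f₁), (normSign σ f₁ : ℚ)],
       ![(normSign σ f₂ : ℚ), (normSign σ (-1 : K) : ℚ) * normSign σ f₂ * normSign σ (1 + f₂), (normSign σ (-1 : K) : ℚ) * normSign σ (1 + f₂)]])
    hω0 hω1 hω2
    (fun a => ∑ᶠ M ∈ {M | M ∈ stratum σ ϖ T a ∧ (LatticeInLevel ϖ ℓ₁ (Matrix.diagonal ![α - 1, β - 1, 0]) M ∧ LatticeInLevel ϖ ℓ₂ (Matrix.diagonal ![(α - 1) * (α - 1), (β - 1) * (β - 1), 0]) M)},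
      (kappaCount σ ϖ 0 i M : ℚ) * stabiliserWeight σ M)
    (cell_core hD hE hT i ℓ₁ ℓ₂)
    (fun s hs => cell_T1 hD hE hT hd2 hfence hℓ₁ hℓ₂ s hs i)
    (fun s hs => cell_T2 hD hE hT hd2 hfence hℓ₁ hℓ₂ s hs i)
    (fun s hs => cell_T3 hD hE hT hd2 hfence hℓ₁ hℓ₂ s hs i)
    (fun ρ s hρ hs => cell_G1 hD h2 hE hN₀ hT hd2 hfence hℓ₁ hℓ₂ ρ s hρ hs i f₀ hσf₀ hf₀)
    (fun ρ s hρ hs => cell_G2 hD h2 hE hN₀ hT hd2 hfence hℓ₁ hℓ₂ ρ s hρ hs i f₁ hσf₁ hf₁)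
    hG3cell
    (fun ρ hρ => cell_H hD h2 hE hN₀ hT hd2 hfence hℓ₁ hℓ₂ ρ hρ i f₀ hσf₀ hf₀)
    hzero
  -- (6) divide by `q − 1`
  set q : ℕ := Fintype.card 𝓀[K] with hq_def
  have hq1 : (1 : ℚ) < q := by exact_mod_cast (Fintype.one_lt_card : 1 < Fintype.card 𝓀[K])
  have hq1' : (q : ℚ) - 1 ≠ 0 := by linarith
  rw [← mul_div_assoc, eq_div_iff hq1', mul_comm]
  exact key

end Summit.HodgeConjecture.HodgeConjecture.Cruxes.H413.F0P3cDyRamLevLabelledTrunkOfBoxSum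

end
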